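import Literature.NumberTheory.Transcendental.KZBetaChains
import Literature.NumberTheory.Transcendental.KZBallVolume

/-!
# `β(a, 1) ∼ [pt, 1/a]`: a Beta representation with unit second exponent is a rational constant

One more fully proved move lemma of the Kontsevich–Zagier calculus (2001, §1.2 rule (3)) for
representations PINNED by domain and integrand, companion of `KZBetaChains.lean`
(`KZ.betaTranslation_equivalent`, integration by parts) and `KZBallVolume.lean`
(`KZ.BallPeeling.betaOne_equivalent_unit_constMul`, `β(1, m+1) ∼ [pt, 1/(m+1)]` for a NATURAL
exponent):

* `KZ.betaFirst_equivalent_unit_constMul` — for a RATIONAL `a > 0`, a representation pinned as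
  `β(a, 1) = [(0,1), t^{a−1}]` is KZ-equivalent to the point representation `[pt, 1/a]`: ONE
  Newton–Leibniz move over the point with the semialgebraic primitive `F(t) = t^a / a` on the
  closed slab `[0,1]` (continuous there, differentiable inside), the null boundary `{0,1}` and
  agreement of the integrands on `(0,1)`. Value identity `B(a, 1) = 1/a`.

With the translation relator this makes every Beta class `β(a, N)`, `N ∈ ℕ`, a rational constant
of the formal period ring (used by the Γ-Hodge sector files of summit KontsevichZagierPeriods).
Everything is proved; no `def`, no named fact.
-/

noncomputable section

open MeasureTheory Set
open Literature.ModelTheory.ExponentialFields (IsSemialgebraic isSemialgebraic_univ)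
open MvPolynomial (aeval X C)

namespace Literature.NumberTheory.Transcendental

namespace KZ

/-- **`β(a, 1) = [(0,1), t^{a−1}] ∼ [pt, 1/a]`** for a rational `a > 0` and a representation pinned
as the Beta representation `β(a, 1)`: ONE Newton–Leibniz move over the point (rule 3, primitive
`F(t) = t^a / a` on the closed slab `[0,1]`, continuous there and differentiable inside,
`F(1) − F(0) = 1/a`), the null boundary `{0, 1}` (rule 1a) and agreement of the integrands on
`(0,1)` (rule 1b). Value identity `B(a, 1) = 1/a`. [cite: KontsevichZagier2001, §1.2 rule (3)] -/
theorem betaFirst_equivalent_unit_constMul (a : ℚ) (ha : 0 < a) (β : IntegralRep 1)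
    (hβd : β.domain = {t | t 0 ∈ Set.Ioo (0:ℝ) 1})
    (hβi : Set.EqOn β.integrand
      (fun t => (t 0) ^ ((a:ℝ) - 1) * (1 - t 0) ^ (((1:ℚ):ℝ) - 1)) β.domain)
    (h : IsAlgebraic ℚ ((a : ℝ)⁻¹)) :
    Equivalent β (IntegralRep.unit.constMul ((a : ℝ)⁻¹) h) := by
  have haR : (0:ℝ) < a := by exact_mod_cast ha
  have ha' : (a:ℝ) ≠ 0 := haR.ne'
  -- the integrand, extended by `0` to the closed interval
  set g : ℝ → ℝ := fun t => if t ∈ Set.Ioo (0:ℝ) 1 then t ^ ((a:ℝ) - 1) else 0 with hgdef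
  have hI : IntegrableOn (fun t : ℝ => t ^ ((a:ℝ) - 1)) (Set.Ioo 0 1) := by
    have h1 := (Literature.Analysis.SpecialFunctions.Selberg.integrableOn_Ioo_rpow_mul_one_sub_rpow_and_integral_eq
      haR one_pos).1
    refine IntegrableOn.congr_fun h1 (fun t _ => ?_) measurableSet_Ioo
    simp
  have hgi : IntegrableOn g (Set.Icc (0:ℝ) 1) := by
    rw [integrableOn_Icc_iff_integrableOn_Ioo]
    exact IntegrableOn.congr_fun hI (fun t ht => by simp only [hgdef, if_pos ht]) measurableSet_Ioo
  have hg_sa : IsSemialgebraicFunOn ℚ {x : Fin 1 → ℝ | x 0 ∈ Set.Icc (0:ℝ) 1}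
      (fun x : Fin 1 → ℝ => g (x 0)) := by
    refine isSemialgebraicFunOn_Icc_of_Ioo ?_ 0 0 (fun x hx => ?_) (fun x hx => ?_)
    · refine (isSemialgebraicFunOn_const_mul_rpow_mul_rpow 1 (a - 1) 0).congr fun x hx => ?_
      have hx' : x 0 ∈ Set.Ioo (0:ℝ) 1 := hx
      simp only [hgdef, if_pos hx', Rat.cast_one, one_mul, Rat.cast_sub, Rat.cast_zero,
        Real.rpow_zero, mul_one]
    · have : x 0 ∉ Set.Ioo (0:ℝ) 1 := fun h => by rw [hx] at h; exact lt_irrefl _ h.1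
      simp only [hgdef, if_neg this, Rat.cast_zero]
    · have : x 0 ∉ Set.Ioo (0:ℝ) 1 := fun h => by rw [hx] at h; exact lt_irrefl _ h.2
      simp only [hgdef, if_neg this, Rat.cast_zero]
  -- the band representation `D = [[0,1], g]`
  obtain ⟨D, hDd, hDi⟩ : ∃ D : IntegralRep 1, D.domain = {x : Fin 1 → ℝ | x 0 ∈ Set.Icc (0:ℝ) 1} ∧
      D.integrand = fun x => g (x 0) :=
    ⟨⟨_, _, isSemialgebraic_setOf_apply_mem_Icc, hg_sa, integrableOn_setOf_apply_mem_iff.2 hgi⟩,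
      rfl, rfl⟩
  -- the primitive `F(t) = t^a / a`
  have hF_sa : IsSemialgebraicFunOn ℚ {x : Fin 1 → ℝ | x 0 ∈ Set.Icc (0:ℝ) 1}
      (fun z : Fin 1 → ℝ => (a:ℝ)⁻¹ * (z 0) ^ (a:ℝ)) := by
    refine isSemialgebraicFunOn_Icc_of_Ioo ?_ 0 a⁻¹ (fun x hx => ?_) (fun x hx => ?_)
    · refine (isSemialgebraicFunOn_const_mul_rpow_mul_rpow a⁻¹ a 0).congr fun x _ => ?_
      simp only [Rat.cast_inv, Rat.cast_zero, Real.rpow_zero, mul_one]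
    · simp only [hx, Real.zero_rpow ha', mul_zero, Rat.cast_zero]
    · simp only [hx, Real.one_rpow, mul_one, Rat.cast_inv]
  set U := IntegralRep.unit.constMul ((a : ℝ)⁻¹) h with hU
  have hUd : U.domain = univ := by rw [hU, IntegralRep.domain_constMul, IntegralRep.unit_domain]
  have hNL : of D - of U ∈ newtonLeibnizRel := by
    refine ⟨0, D, U, fun _ => ((0:ℕ):ℝ), fun _ => ((0:ℕ):ℝ) + 1,
      fun z => (a:ℝ)⁻¹ * (z (Fin.last 0)) ^ (a:ℝ), by rw [hDd]; exact hF_sa,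
      by rw [hUd]; exact isSemialgebraicFunOn_natCast isSemialgebraic_univ 0, ?_,
      fun _ _ => by simp, ?_, ?_, ?_, ?_, rfl⟩
    · rw [hUd]
      exact (isSemialgebraicFunOn_aeval isSemialgebraic_univ
        (((0:ℕ) : MvPolynomial (Fin 0) ℚ) + 1)).congr fun x _ => by simp
    · rw [hDd, hUd]
      ext z
      simp only [mem_univ, true_and, mem_setOf_eq, mem_Icc, Nat.cast_zero, zero_add]
      rfl
    · intro x _
      simp only [Fin.snoc_last, Nat.cast_zero, zero_add]
      exact continuousOn_const.mul (continuousOn_id.rpow_const fun t _ => Or.inr haR.le)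
    · intro x _ t ht
      simp only [Nat.cast_zero, zero_add] at ht
      simp only [Fin.snoc_last, hDi]
      rw [show (0 : Fin 1) = Fin.last 0 from rfl, Fin.snoc_last]
      have hgt : g t = t ^ ((a:ℝ) - 1) := by simp only [hgdef, if_pos ht]
      rw [hgt]
      have hd : HasDerivAt (fun s : ℝ => (a:ℝ)⁻¹ * s ^ (a:ℝ)) (t ^ ((a:ℝ) - 1)) t := by
        have h0 := (Real.hasDerivAt_rpow_const (p := (a:ℝ)) (Or.inl ht.1.ne')).const_mul (a:ℝ)⁻¹
        have heq : (a:ℝ)⁻¹ * ((a:ℝ) * t ^ ((a:ℝ) - 1)) = t ^ ((a:ℝ) - 1) := by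
          rw [← mul_assoc, inv_mul_cancel₀ ha', one_mul]
        rwa [heq] at h0
      exact hd
    · intro x _
      simp only [hU, IntegralRep.integrand_constMul, IntegralRep.unit_integrand, Fin.snoc_last,
        Nat.cast_zero, zero_add, Real.one_rpow, Real.zero_rpow ha', mul_one, mul_zero, sub_zero]
  have hD_mem : of D - of U ∈ relations := newtonLeibnizRel_subset_relations hNL
  -- its open restriction
  have hsub : {x : Fin 1 → ℝ | x 0 ∈ Set.Ioo (0:ℝ) 1} ⊆ D.domain := by
    rw [hDd]
    exact fun x hx => ⟨hx.1.le, hx.2.le⟩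
  set D₀ := D.restrict _ BallPeeling.isSemialgebraic_posIoo hsub with hD₀
  have h1 : of D - of D₀ ∈ relations :=
    D.of_sub_of_restrict_mem_relations BallPeeling.isSemialgebraic_posIoo hsub
      (by rw [hDd]; exact volume_setOf_Icc_diff_Ioo)
  -- `β` and `D₀` agree
  have h2 : of β - of D₀ ∈ relations := by
    refine of_sub_of_mem_relations_of_eqOn (by rw [hβd]; rfl) fun x hx => ?_
    have hx' : x 0 ∈ Set.Ioo (0:ℝ) 1 := by rw [hβd] at hx; exact hx
    rw [hβi hx]
    simp only [hD₀, IntegralRep.integrand_restrict, hDi, hgdef, if_pos hx', Rat.cast_one, sub_self,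
      Real.rpow_zero, mul_one]
  have := relations.add_mem (relations.sub_mem h2 h1) hD_mem
  have h' : of β - of D₀ - (of D - of D₀) + (of D - of U) = of β - of U := by abel
  rw [h'] at this
  exact this

end KZ

end Literature.NumberTheory.Transcendental

end
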